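import Mathlib
import Summits.NavierStokesRegularity.NavierStokesRegularity.Theorems.LevelSetModerationHighSpeedPressureWorkFastSetGradientBricks

/-!
# Route LevelSetModeration — `HighSpeedPressureWork`: the Duhamel gradient from any interior time (toward the log-free fast-set bound)

Support file for item stmt-NavierStokesRegularity-18149 (`HighSpeedPressureWork`), stub
`stub_earlyBookkeeping` (margin zero). Sharpening of `levelSetModeration_fastSetGradient_unit`
(`…FastSetGradientUnit.lean`): at a fast point the speed gradient is bounded by an ABSOLUTE
constant in the unit normalisation (no `√log(1/t)`),

  `‖∇‖u(t,·)‖(x)‖ ≤ A`   for `t ∈ (0,T)`, `t ≤ ε`, `‖u(t,x)‖ > 1/2`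

(`levelSetModeration_fastSetGradient_logFree_unit`, next file; `ν = 1`, speed `≤ 1`, datum `≤ 1/2`).
This file supplies its Duhamel-gradient input from an ARBITRARY interior time `s`
(`levelSetModeration_norm_fderiv_oseenDuhamel_le_from`), generalising the `s = t/2` lemma of
`…FastSetGradientBricks.lean`.

Plan of the log-free bound. Mild formula from the EARLY time `s₀ = t²` (so that the overshoot by time `s₀` is
`≤ C₃ t ≪ √t`); frozen direction `e`; caloric deficit `f(σ,·) = e^{(σ−s₀)Δ}(B_s − e·u(s₀))`,
`δ = f(t, x)`. The Duhamel term at the fast point is estimated slice by slice by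
`levelSetModeration_oseenSlice_source_le` with the radius `r(σ) = √((t−σ) ℓ)`, `ℓ = log(1/(2δ))`,
inside which the sharp Harnack inequality (`heatExtension_le_harnack_shift`) gives
`f(σ,·) ≤ ((t−s₀)/(σ−s₀))^{3/2} e^{ℓ/4} δ = ((t−s₀)/(σ−s₀))^{3/2} (2δ)^{-1/4} δ`; integrating,
`‖B_{s₀}(u,u)(t,x)‖ ≤ c₁ δ^{3/8} √t + c₂ t + c₃ √t/√ℓ`, whence, by fastness, either `δ ≤ t²` or
`δ √(log(1/(2δ))) ≤ a √t`. Hamilton's logarithmic gradient estimate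
(`norm_fderiv_heatExtension_le_mul_sqrt_log`) then bounds `‖∇f(t,x)‖` by a constant, and the
Duhamel gradient from `s₀` is bounded (`levelSetModeration_norm_fderiv_oseenDuhamel_le_from`,
the early rate `‖∇u(σ)‖ ≤ C/√σ` integrated against `(t−σ)^{-1/2}`).
-/

noncomputable section

-- single-conjunct summit: `Summit.<Summit>.<Problem>` repeats the name by the D-0017 layout
set_option linter.dupNamespace false

namespace Summit.NavierStokesRegularity.NavierStokesRegularity.Theorems

open MeasureTheory Set Filter Topology Function Metric
open scoped ENNReal RealInnerProductSpace
open Literature.Analysis.FluidPDE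

/-! ### The Duhamel gradient from an arbitrary interior time -/

/-- **Bounded gradient of the Duhamel term from any interior time** (`ν = 1`, speed `≤ 1`):
there is an absolute `P ≥ 0` such that for every classical solution on `ℝ³ × (0, b)` with
`‖u‖ ≤ 1` on `(0, T] × ℝ³` (`T < b`), `‖u(t)‖_{L²} ≤ K < ∞` there, all `0 < s < t < T` with
`t ≤ 1`: `y ↦ B_s(u,u)(t)(y)` is differentiable with `‖D B_s(u,u)(t)(x)‖ ≤ P` (derivative on the
data, slice bound `2C₀(t−σ)^{-1/2}‖∇u(σ)‖_∞`, early rate `‖∇u(σ)‖ ≤ C/√σ ≤ C/√(σ − s)`, and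
`∫ₛᵗ (t−σ)^{-1/2}(σ−s)^{-1/2} dσ ≤ 8`). [folklore] -/
theorem levelSetModeration_norm_fderiv_oseenDuhamel_le_from :
    ∃ P : ℝ, 0 ≤ P ∧ ∀ {b T : ℝ} {u : ℝ → EuclideanSpace ℝ (Fin 3) → EuclideanSpace ℝ (Fin 3)} {p : ℝ → EuclideanSpace ℝ (Fin 3) → ℝ}, Literature.Analysis.FluidPDE.IsClassicalNSSolutionOn (Set.Ioo 0 b) 1 0 u p → 0 < T → T < b → (∀ t ∈ Set.Ioc 0 T, ∀ x, ‖u t x‖ ≤ 1) → ∀ {K : ENNReal}, K ≠ ⊤ → (∀ t ∈ Set.Ioc 0 T, MeasureTheory.eLpNorm (u t) 2 MeasureTheory.volume ≤ K) → ∀ {s t : ℝ}, 0 < s → s < t → t < T → t ≤ 1 → ∀ x, HasFDerivAt (fun y => Literature.Analysis.FluidPDE.oseenDuhamel 1 s u u t y) (fderiv ℝ (fun y => Literature.Analysis.FluidPDE.oseenDuhamel 1 s u u t y) x) x ∧ ‖fderiv ℝ (fun y => Literature.Analysis.FluidPDE.oseenDuhamel 1 s u u t y) x‖ ≤ P :=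 by
  obtain ⟨Cg, hCg0, hG⟩ := earlyBookkeeping_norm_fderiv_le_unit
  obtain ⟨CS, hCS, hS⟩ := exists_norm_oseenSlice_le (E := EuclideanSpace ℝ (Fin 3))
  refine ⟨2 * CS * Cg * 8, by positivity, ?_⟩
  intro b T u p hcl hT hTb hbd K hK hL2 s t hs hst htT ht1 x
  classical
  -- the cut-off field (jointly measurable)
  set S : Set (ℝ × EuclideanSpace ℝ (Fin 3)) := Ioo 0 T ×ˢ univ with hSdef
  set U : ℝ → EuclideanSpace ℝ (Fin 3) → EuclideanSpace ℝ (Fin 3) :=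
    fun τ y => if τ ∈ Ioo 0 T then u τ y else 0 with hU
  have hUeq : ∀ {τ : ℝ}, τ ∈ Ioo 0 T → U τ = u τ := by
    intro τ hτ; funext y; simp only [hU, if_pos hτ]
  have hUunc : uncurry U = S.piecewise (uncurry u) 0 := by
    funext z
    obtain ⟨τ, y⟩ := z
    by_cases hτ : τ ∈ Ioo 0 T
    · have hz : (τ, y) ∈ S := mk_mem_prod hτ (mem_univ y)
      simp only [uncurry_apply_pair, hU, if_pos hτ, piecewise_eq_of_mem _ _ _ hz]
    · have hz : (τ, y) ∉ S := fun h => hτ (mem_prod.1 h).1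
      simp only [uncurry_apply_pair, hU, if_neg hτ, piecewise_eq_of_notMem _ _ _ hz,
        Pi.zero_apply]
  have hmeas : Measurable (uncurry U) := by
    rw [hUunc]
    refine ContinuousOn.measurable_piecewise ?_ continuousOn_const
      (measurableSet_Ioo.prod MeasurableSet.univ)
    exact hcl.smooth_velocity.continuousOn.mono (prod_mono (Ioo_subset_Ioo_right hTb.le) subset_rfl)
  have hIoo : ∀ {τ : ℝ}, τ ∈ Ioo s t → τ ∈ Ioo 0 T := fun hτ => ⟨hs.trans hτ.1, hτ.2.trans htT⟩
  have hIob : ∀ {τ : ℝ}, τ ∈ Ioo s t → τ ∈ Ioo 0 b := fun hτ =>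
    ⟨hs.trans hτ.1, (hτ.2.trans htT).trans hTb⟩
  have hU1 : ∀ τ ∈ Ioo s t, ∀ y, ‖U τ y‖ ≤ (fun _ => (1 : ℝ)) τ := by
    intro τ hτ y
    rw [hUeq (hIoo hτ)]
    exact hbd τ ⟨hs.trans hτ.1, (hτ.2.trans htT).le⟩ y
  -- the gradient rate on `(s, t)`: `‖∇u(σ)‖ ≤ Cg (σ - s)^{-1/2}`
  have hgrad : ∀ τ ∈ Ioo s t, ∀ y, ‖fderiv ℝ (u τ) y‖ ≤ Cg * (τ - s) ^ (-(1 / 2 : ℝ)) := by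
    intro τ hτ y
    have h1 := hG hcl hT hTb hbd hK hL2 τ ⟨hs.trans hτ.1, hτ.2.trans htT⟩ (hτ.2.le.trans ht1) y
    refine h1.trans ?_
    have hτs : 0 < τ - s := sub_pos.2 hτ.1
    rw [Real.rpow_neg hτs.le, ← Real.sqrt_eq_rpow, div_eq_mul_inv]
    refine mul_le_mul_of_nonneg_left ?_ hCg0
    exact inv_anti₀ (Real.sqrt_pos.2 hτs) (Real.sqrt_le_sqrt (by linarith))
  -- the slice-level derivative bound
  set bound : ℝ → ℝ := fun τ => 2 * CS * Cg * ((t - τ) ^ (-(1 / 2 : ℝ)) * (τ - s) ^ (-(1 / 2 : ℝ)))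
    with hbound
  have hb : ∀ τ ∈ Ioo s t, ∀ y,
      ‖fderiv ℝ (oseenSlice (1 * (t - τ)) (U τ) (U τ)) y‖ ≤ bound τ := by
    intro τ hτ y
    have hσ : 0 < t - τ := sub_pos.2 hτ.2
    have hτs : 0 < τ - s := sub_pos.2 hτ.1
    rw [one_mul, hUeq (hIoo hτ)]
    have hc1 : ContDiff ℝ 1 (u τ) := contDiff_infty.1 (hcl.contDiff_velocity (hIob hτ)) 1
    have hu1 : ∀ y, ‖u τ y‖ ≤ 1 := fun y => hbd τ ⟨hs.trans hτ.1, (hτ.2.trans htT).le⟩ y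
    set D : ℝ := Cg * (τ - s) ^ (-(1 / 2 : ℝ)) with hD
    have hD0 : 0 ≤ D := by rw [hD]; exact mul_nonneg hCg0 (Real.rpow_nonneg hτs.le _)
    have hDu : ∀ y, ‖fderiv ℝ (u τ) y‖ ≤ D := hgrad τ hτ
    have hnn : 0 ≤ bound τ := by
      simp only [hbound]
      exact mul_nonneg (by positivity) (mul_nonneg (Real.rpow_nonneg hσ.le _)
        (Real.rpow_nonneg hτs.le _))
    refine ContinuousLinearMap.opNorm_le_bound _ hnn fun h => ?_
    rw [fderiv_oseenSlice_apply_of_contDiff hσ hc1 hc1 hu1 hu1 hDu hDu y h]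
    have ha : ∀ z, ‖fderiv ℝ (u τ) z h‖ ≤ D * ‖h‖ := fun z =>
      (ContinuousLinearMap.le_opNorm _ _).trans (mul_le_mul_of_nonneg_right (hDu z) (norm_nonneg _))
    have h1 := hS hσ (a := fun z => fderiv ℝ (u τ) z h) (b := u τ) ha hu1 y
    have h2 := hS hσ (a := u τ) (b := fun z => fderiv ℝ (u τ) z h) hu1 ha y
    calc ‖oseenSlice (t - τ) (fun z => fderiv ℝ (u τ) z h) (u τ) y +
          oseenSlice (t - τ) (u τ) (fun z => fderiv ℝ (u τ) z h) y‖
        ≤ CS * (t - τ) ^ (-(1 / 2 : ℝ)) * (D * ‖h‖) * 1 +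
          CS * (t - τ) ^ (-(1 / 2 : ℝ)) * 1 * (D * ‖h‖) :=
          (norm_add_le _ _).trans (add_le_add h1 h2)
      _ = bound τ * ‖h‖ := by simp only [hbound, hD]; ring
  -- integrability of the weights
  have hIi := intervalIntegrable_rpow_neg_mul_rpow_neg (a := 1 / 2) (b := 1 / 2) (s := s) (t := t)
    (by norm_num) (by norm_num) hst
  have hww : IntegrableOn (fun τ => (t - τ) ^ (-(1 / 2 : ℝ)) * (τ - s) ^ (-(1 / 2 : ℝ)))
      (Ioo s t) volume := (hIi.1).mono_set Ioo_subset_Ioc_self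
  have hone : IntegrableOn (fun τ => (t - τ) ^ (-(1 / 2 : ℝ))) (Ioo s t) volume := by
    have := ((intervalIntegral.intervalIntegrable_rpow' (a := t - s) (b := 0)
      (by norm_num : (-1 : ℝ) < -(1 / 2 : ℝ))).comp_sub_left t)
    have h2 : IntervalIntegrable (fun τ => (t - τ) ^ (-(1 / 2 : ℝ))) volume s t := by simpa using this
    exact (h2.1).mono_set Ioo_subset_Ioc_self
  have hdom : IntegrableOn (fun τ => (t - τ) ^ (-(1 / 2 : ℝ)) *
      ((fun _ => (1 : ℝ)) τ * (fun _ => (1 : ℝ)) τ)) (Ioo s t) volume := by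
    refine hone.congr_fun (fun τ _ => ?_) measurableSet_Ioo
    simp only [mul_one]
  have hbi : IntegrableOn bound (Ioo s t) volume := by
    rw [hbound]
    exact hww.const_mul (2 * CS * Cg)
  -- the Duhamel terms of `U` and `u` agree
  have hcongr : (fun y => oseenDuhamel 1 s U U t y) = fun y => oseenDuhamel 1 s u u t y := by
    funext y
    exact LongLivedOseenSolution.oseenDuhamel_congr (fun τ hτ => hUeq (hIoo hτ))
      (fun τ hτ => hUeq (hIoo hτ)) y
  have hderU := hasFDerivAt_oseenDuhamel hmeas hmeas hU1 hU1 hdom hb hbi x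
  have hnormU := norm_fderiv_oseenDuhamel_le hmeas hmeas hU1 hU1 hdom hb hbi x
  rw [hcongr] at hderU hnormU
  refine ⟨?_, hnormU.trans ?_⟩
  · rw [hderU.fderiv]; exact hderU
  -- `∫_{(s,t)} bound ≤ 2 CS Cg · 8`
  have hval : ∫ τ in Ioo s t, (t - τ) ^ (-(1 / 2 : ℝ)) * (τ - s) ^ (-(1 / 2 : ℝ)) ≤ 8 := by
    rw [← integral_Ioc_eq_integral_Ioo, ← intervalIntegral.integral_of_le hst.le]
    have h := integral_rpow_neg_mul_rpow_neg_le (a := 1 / 2) (b := 1 / 2) (s := s) (t := t)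
      (by norm_num) (by norm_num) (by norm_num) (by norm_num) hst
    refine h.trans ?_
    rw [show (1 : ℝ) / 2 + 1 / 2 - 1 = 0 by norm_num, Real.rpow_zero,
      show (1 : ℝ) - 1 / 2 - 1 / 2 = 0 by norm_num, Real.rpow_zero]
    norm_num
  rw [hbound, integral_const_mul]
  exact mul_le_mul_of_nonneg_left hval (by positivity)

end Summit.NavierStokesRegularity.NavierStokesRegularity.Theorems

end
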